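import Summits.QuantumFields.YangMills.Theorems.ColdStartUniversalityLatticeLangevinLiebRobinsonWordLightCone
import Summits.QuantumFields.YangMills.Theorems.ColdStartUniversalityLatticeLangevinLiebRobinsonMixingTime
import HarnessLib

/-!
# Route `ColdStartUniversality` (fixed-cut-off SZZ dynamics; LIEB–ROBINSON / LOCALITY package, file 13):
# ★★★ UNIFORMLY IN TIME, a fixed Wilson loop forgets the far-away part of its initial condition (`|β'| < 1/12`, every volume)

Helper file (seat `ym-line-csu-p1`, g30; `--supports stmt-QuantumFields-24809`).  The two halves of the package combined: the light cone
(`word_lightCone`, short times) and every-start mixing (`wilson_word_pointwise_mixing_uniform`, long times) give a bound that is UNIFORM IN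
TIME and exponentially small in the distance.  `SU(2)` SZZ dynamics on `(ℤ/L)³`, `ρ = 1 − 12|β'|`, `λ = (1300+4√2)|β'|`:
* ★★ `wilson_word_mixing_halfRate` — pure-exponential every-start mixing of a fixed word: `≤ 12√2π|w|²(6(7+6λ/ρ)³+2)·e^(−ρt/2)`;
* ★★★ `word_farStart_uniform_in_time` — if two starts `y, y'` agree on every link within cyclic sup-distance `R` of the links of the word `w`,
  then FOR ALL `t ≥ 0`: `|κ_t(Re tr w)(y) − κ_t(Re tr w)(y')| ≤ 24√2π|w|²(6(7+6λ/ρ)³+2)·exp(−ρ(R+1)log 2/(2λ+ρ))` — what the initial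
  condition looks like at distance `> R` from the loop (e.g. COLD versus anything else out there) changes the loop expectation by an
  amount exponentially small in `R`, at every time and in every volume (case split at `t* = (R+1)log 2/(λ+ρ/2)`: light cone before, mixing
  of both starts after);
* ★★★ `local_farStart_uniform_in_time` — the same for a general `C⁵` local observable with a link-Lipschitz profile supported in `Λ`
  (constant `12√2Σℓ + 24π#Λ√(Σℓ²)(6(7+6λ/ρ)³+2)`);
* ★★★ `solution_word_farStart_uniform_in_time` — the word statement for two strong solutions on possibly different filtered probability spaces.
THEOREMS ONLY, no definition, no sorry; [folklore].  HONEST FRAMING: fixed cut-off and FIXED `|β'| < 1/12`; the route's scaling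
`β'_K = (γε_K)⁻¹/2 → ∞` leaves the window and blows the slope `λ` up, so nothing here is `K`-uniform; `UniformColdStartMixing` (24809) is NOT
restated; no crux, rung or summit statement is proved; the Yang–Mills mass gap is NOT proved.
-/

set_option autoImplicit false

noncomputable section

namespace Summit.QuantumFields.YangMills.Theorems.ColdStartUniversality.LiebRobinson

open MeasureTheory ProbabilityTheory Matrix Complex Finset Filter Set Metric
open scoped ComplexConjugate BigOperators Matrix NNReal ENNReal Topology
open Literature.Probability.Process Literature.MathematicalPhysics.QuantumFieldTheory
open Literature.MathematicalPhysics.QuantumFieldTheory.Balaban1983to89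
open Literature.MathematicalPhysics.QuantumLattice (fundamentalRep fundamentalLatticeRep continuous_fundamentalRep fundamentalRep_apply)

variable {L : ℕ} [NeZero L]

/-! ## §1. Pure-exponential every-start mixing of a fixed word -/

/-- ★★ **Every-start mixing of a fixed Wilson loop word, pure-exponential form** (`|β'| < 1/12`, every volume, every realising kernel
family, every start `x`, every `t`): `|κ_t(Re tr w)(x) − ∫ Re tr w dμ_(β')| ≤ 12√2π|w|²·(6(7+6λ/ρ)³+2)·e^(−ρt/2)`. [folklore] -/
theorem wilson_word_mixing_halfRate (L : ℕ) [NeZero L] (β' : ℝ) (hβ : |β'| < 1 / 12)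
    (κ : ℝ≥0 → Kernel (GaugeConfig 3 L (Matrix.specialUnitaryGroup (Fin 2) ℂ))
      (GaugeConfig 3 L (Matrix.specialUnitaryGroup (Fin 2) ℂ))) [∀ t, IsMarkovKernel (κ t)]
    (hreal : ∀ (t : ℝ≥0) (x : GaugeConfig 3 L (Matrix.specialUnitaryGroup (Fin 2) ℂ))
        (Ω : Type) [MeasurableSpace Ω] (P : Measure Ω) [IsProbabilityMeasure P]
        (W : ℝ≥0 → Ω → (Edge 3 L × NoiseIdx 2 → ℝ)) (hW : IsFlatBrownian W P)
        (U : ℝ≥0 → Ω → GaugeConfig 3 L (Matrix.specialUnitaryGroup (Fin 2) ℂ)),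
        (∀ ω, U 0 ω = x) →
        (latticeLangevinDynamics (fundamentalLatticeRep 2) β').IsSolution (fundamentalRep (Fin 2))
          hW.natFiltration P W U →
        κ t x = P.map (U t))
    (l : List (Edge 3 L × Bool)) (t : ℝ≥0) (x : (GaugeConfig 3 L (Matrix.specialUnitaryGroup (Fin 2) ℂ))) :
    let coords : GaugeConfig 3 L (Matrix.specialUnitaryGroup (Fin 2) ℂ) → (Edge 3 L × Fin 2 × Fin 2 × Bool → ℝ) :=
      fun V q => (fun z : ℂ => if q.2.2.2 then z.im else z.re)
        ((fundamentalRep (Fin 2) (V q.1) : Matrix (Fin 2) (Fin 2) ℂ) q.2.1 q.2.2.1)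
    |∫ y, (fun y : (Edge 3 L × Fin 2 × Fin 2 × Bool → ℝ) => ((l.map (fun a : Edge 3 L × Bool => if a.2 then ((fun (ee : Edge 3 L) => Matrix.of fun (i j : Fin 2) => ((y (ee, i, j, false) : ℝ) : ℂ) + ((y (ee, i, j, true) : ℝ) : ℂ) * Complex.I) a.1)ᴴ else (fun (ee : Edge 3 L) => Matrix.of fun (i j : Fin 2) => ((y (ee, i, j, false) : ℝ) : ℂ) + ((y (ee, i, j, true) : ℝ) : ℂ) * Complex.I) a.1)).prod).trace.re) (coords y) ∂(κ t x) - ∫ y, (fun y : (Edge 3 L × Fin 2 × Fin 2 × Bool → ℝ) => ((l.map (fun a : Edge 3 L × Bool => if a.2 then ((fun (ee : Edge 3 L) => Matrix.of fun (i j : Fin 2) => ((y (ee, i, j, false) : ℝ) : ℂ) + ((y (ee, i, j, true) : ℝ) : ℂ) * Complex.I) a.1)ᴴ else (fun (ee : Edge 3 L) => Matrix.of fun (i j : Fin 2) => ((y (ee, i, j, false) : ℝ) : ℂ) + ((y (ee, i, j, true) : ℝ) : ℂ) * Complex.I) a.1)).prod).trace.re) (coords y) ∂(wilsonMeasure (d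 := 3) (L := L) (fundamentalRep (Fin 2)) β')| ≤
      12 * Real.sqrt 2 * Real.pi * (l.length : ℝ) ^ 2 * (6 * (7 + 6 * ((1300 + 4 * Real.sqrt 2) * |β'|) / (1 - 12 * |β'|)) ^ 3 + 2) * Real.exp (-((1 - 12 * |β'|) / 2 * (t : ℝ))) := by
  intro coords
  have h := wilson_word_pointwise_mixing_uniform L β' hβ κ hreal l t x
  have hρ : 0 < (1 - 12 * |β'|) := by linarith
  have ha : 0 ≤ ((1300 + 4 * Real.sqrt 2) * |β'|) + (1 - 12 * |β'|) := by positivity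
  have hpoly := lightCone_poly_mul_exp_le_halfRate ha hρ (NNReal.coe_nonneg t)
  have h7 : 1 + 6 * (((1300 + 4 * Real.sqrt 2) * |β'|) + (1 - 12 * |β'|)) / (1 - 12 * |β'|) = 7 + 6 * ((1300 + 4 * Real.sqrt 2) * |β'|) / (1 - 12 * |β'|) := by
    have h6 : (6 : ℝ) * (1 - 12 * |β'|) / (1 - 12 * |β'|) = 6 := mul_div_cancel_right₀ 6 hρ.ne'
    calc 1 + 6 * (((1300 + 4 * Real.sqrt 2) * |β'|) + (1 - 12 * |β'|)) / (1 - 12 * |β'|) = 1 + (6 * ((1300 + 4 * Real.sqrt 2) * |β'|) / (1 - 12 * |β'|) + 6 * (1 - 12 * |β'|) / (1 - 12 * |β'|)) := by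
          rw [mul_add, add_div]
      _ = 7 + 6 * ((1300 + 4 * Real.sqrt 2) * |β'|) / (1 - 12 * |β'|) := by rw [h6]; ring
  rw [h7] at hpoly
  have hK : 0 ≤ 12 * Real.sqrt 2 * Real.pi * (l.length : ℝ) ^ 2 := by positivity
  calc |∫ y, (fun y : (Edge 3 L × Fin 2 × Fin 2 × Bool → ℝ) => ((l.map (fun a : Edge 3 L × Bool => if a.2 then ((fun (ee : Edge 3 L) => Matrix.of fun (i j : Fin 2) => ((y (ee, i, j, false) : ℝ) : ℂ) + ((y (ee, i, j, true) : ℝ) : ℂ) * Complex.I) a.1)ᴴ else (fun (ee : Edge 3 L) => Matrix.of fun (i j : Fin 2) => ((y (ee, i, j, false) : ℝ) : ℂ) + ((y (ee, i, j, true) : ℝ) : ℂ) * Complex.I) a.1)).prod).trace.re) (coords y) ∂(κ t x) - ∫ y, (fun y : (Edge 3 L × Fin 2 × Fin 2 × Bool → ℝ) => ((l.map (fun a : Edge 3 L × Bool => if a.2 then ((fun (ee : Edge 3 L) => Matrix.of fun (i j : Fin 2) => ((y (ee, i, j, false) : ℝ) : ℂ) + ((y (ee, i, j, true) : ℝ)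 : ℂ) * Complex.I) a.1)ᴴ else (fun (ee : Edge 3 L) => Matrix.of fun (i j : Fin 2) => ((y (ee, i, j, false) : ℝ) : ℂ) + ((y (ee, i, j, true) : ℝ) : ℂ) * Complex.I) a.1)).prod).trace.re) (coords y) ∂(wilsonMeasure (d := 3) (L := L) (fundamentalRep (Fin 2)) β')|
      ≤ 12 * Real.sqrt 2 * Real.pi * (l.length : ℝ) ^ 2 * ((3 * (((1300 + 4 * Real.sqrt 2) * |β'| + (1 - 12 * |β'|)) * (t : ℝ)) + 1) ^ 3 + 2) * Real.exp (-((1 - 12 * |β'|) * (t : ℝ))) := h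
    _ = 12 * Real.sqrt 2 * Real.pi * (l.length : ℝ) ^ 2 * (((3 * (((1300 + 4 * Real.sqrt 2) * |β'| + (1 - 12 * |β'|)) * (t : ℝ)) + 1) ^ 3 + 2) * Real.exp (-((1 - 12 * |β'|) * (t : ℝ)))) := by ring
    _ ≤ 12 * Real.sqrt 2 * Real.pi * (l.length : ℝ) ^ 2 * ((6 * (7 + 6 * ((1300 + 4 * Real.sqrt 2) * |β'|) / (1 - 12 * |β'|)) ^ 3 + 2) * Real.exp (-((1 - 12 * |β'|) / 2 * (t : ℝ)))) := mul_le_mul_of_nonneg_left hpoly hK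
    _ = 12 * Real.sqrt 2 * Real.pi * (l.length : ℝ) ^ 2 * (6 * (7 + 6 * ((1300 + 4 * Real.sqrt 2) * |β'|) / (1 - 12 * |β'|)) ^ 3 + 2) * Real.exp (-((1 - 12 * |β'|) / 2 * (t : ℝ))) := by ring

/-! ## §2. Uniform-in-time insensitivity to the far-away initial condition -/

/-- ★★★ **Uniformly in time, a fixed Wilson loop forgets the far-away part of its initial condition** (`|β'| < 1/12`, every volume
`L`).  For every word `w`, every realising kernel family, every `R` and all starts `y, y'` agreeing on every link whose base site is within
cyclic sup-distance `R` of the base site of a link of `w`, and EVERY `t ≥ 0`: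
`|κ_t(Re tr w)(y) − κ_t(Re tr w)(y')| ≤ 24√2π|w|²·(6(7+6λ/ρ)³+2)·exp(−ρ(R+1)log 2/(2λ+ρ))`.
Proof: with `s = (R+1)log 2` and `t* = s/(λ+ρ/2)`, for `t ≤ t*` the light cone gives `C_w e^(λt−s) ≤ C_w e^(−ρt*/2)`; for `t ≥ t*` the
every-start mixing of BOTH starts gives `2·12√2π|w|²C₁e^(−ρt/2) ≤ C_wC₁e^(−ρt*/2)`; and `ρt*/2 = ρs/(2λ+ρ)`. [folklore] -/
theorem word_farStart_uniform_in_time (L : ℕ) [NeZero L] (β' : ℝ) (hβ : |β'| < 1 / 12)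
    (κ : ℝ≥0 → Kernel (GaugeConfig 3 L (Matrix.specialUnitaryGroup (Fin 2) ℂ))
      (GaugeConfig 3 L (Matrix.specialUnitaryGroup (Fin 2) ℂ))) [∀ t, IsMarkovKernel (κ t)]
    (hreal : ∀ (t : ℝ≥0) (x : GaugeConfig 3 L (Matrix.specialUnitaryGroup (Fin 2) ℂ))
        (Ω : Type) [MeasurableSpace Ω] (P : Measure Ω) [IsProbabilityMeasure P]
        (W : ℝ≥0 → Ω → (Edge 3 L × NoiseIdx 2 → ℝ)) (hW : IsFlatBrownian W P)
        (U : ℝ≥0 → Ω → GaugeConfig 3 L (Matrix.specialUnitaryGroup (Fin 2) ℂ)),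
        (∀ ω, U 0 ω = x) →
        (latticeLangevinDynamics (fundamentalLatticeRep 2) β').IsSolution (fundamentalRep (Fin 2))
          hW.natFiltration P W U →
        κ t x = P.map (U t))
    (l : List (Edge 3 L × Bool)) (R : ℕ) (y y' : (GaugeConfig 3 L (Matrix.specialUnitaryGroup (Fin 2) ℂ)))
    (hyy' : ∀ e₀ : Edge 3 L, (∃ e ∈ (l.map Prod.fst).toFinset, (Finset.univ.sup fun i : Fin 3 => ((e.1 i - e₀.1 i).valMinAbs).natAbs) ≤ R) → y e₀ = y' e₀) (t : ℝ≥0) :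
    let coords : GaugeConfig 3 L (Matrix.specialUnitaryGroup (Fin 2) ℂ) → (Edge 3 L × Fin 2 × Fin 2 × Bool → ℝ) :=
      fun V q => (fun z : ℂ => if q.2.2.2 then z.im else z.re)
        ((fundamentalRep (Fin 2) (V q.1) : Matrix (Fin 2) (Fin 2) ℂ) q.2.1 q.2.2.1)
    |∫ z, (fun y : (Edge 3 L × Fin 2 × Fin 2 × Bool → ℝ) => ((l.map (fun a : Edge 3 L × Bool => if a.2 then ((fun (ee : Edge 3 L) => Matrix.of fun (i j : Fin 2) => ((y (ee, i, j, false) : ℝ) : ℂ) + ((y (ee, i, j, true) : ℝ) : ℂ) * Complex.I) a.1)ᴴ else (fun (ee : Edge 3 L) => Matrix.of fun (i j : Fin 2) => ((y (ee, i, j, false) : ℝ) : ℂ) + ((y (ee, i, j, true) : ℝ) : ℂ) * Complex.I) a.1)).prod).trace.re) (coords z) ∂(κ t y) - ∫ z, (fun y : (Edge 3 L × Fin 2 × Fin 2 × Bool → ℝ) => ((l.map (fun a : Edge 3 L × Bool => if a.2 then ((fun (ee : Edge 3 L) => Matrix.of fun (i j : Fin 2) => ((y (ee, i, j, false) : ℝ)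 : ℂ) + ((y (ee, i, j, true) : ℝ) : ℂ) * Complex.I) a.1)ᴴ else (fun (ee : Edge 3 L) => Matrix.of fun (i j : Fin 2) => ((y (ee, i, j, false) : ℝ) : ℂ) + ((y (ee, i, j, true) : ℝ) : ℂ) * Complex.I) a.1)).prod).trace.re) (coords z) ∂(κ t y')| ≤ (24 * Real.sqrt 2 * Real.pi * (l.length : ℝ) ^ 2) * (6 * (7 + 6 * ((1300 + 4 * Real.sqrt 2) * |β'|) / (1 - 12 * |β'|)) ^ 3 + 2) * Real.exp (-((1 - 12 * |β'|) * (((R : ℝ) + 1) * Real.log 2) / (2 * ((1300 + 4 * Real.sqrt 2) * |β'|) + (1 - 12 * |β'|)))) := by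
  intro coords
  have hρ : 0 < (1 - 12 * |β'|) := by linarith
  have hlam0 : 0 ≤ ((1300 + 4 * Real.sqrt 2) * |β'|) := by positivity
  have hlamK : (|β'| * (4 + 4 * Real.sqrt 2 + 12 * 108)) = ((1300 + 4 * Real.sqrt 2) * |β'|) := by ring
  set s : ℝ := ((R : ℝ) + 1) * Real.log 2 with hs
  have hlog2 : 0 < Real.log 2 := Real.log_pos (by norm_num)
  have hs0 : 0 ≤ s := by rw [hs]; positivity
  have hden : 0 < ((1300 + 4 * Real.sqrt 2) * |β'|) + (1 - 12 * |β'|) / 2 := by linarith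
  set tstar : ℝ := s / (((1300 + 4 * Real.sqrt 2) * |β'|) + (1 - 12 * |β'|) / 2) with htstar
  have htstar0 : 0 ≤ tstar := div_nonneg hs0 hden.le
  have hsplit : ((1300 + 4 * Real.sqrt 2) * |β'|) * tstar + (1 - 12 * |β'|) / 2 * tstar = s := by
    rw [← add_mul, htstar, mul_div_cancel₀ s hden.ne']
  have htarget : (1 - 12 * |β'|) / 2 * tstar = (1 - 12 * |β'|) * s / (2 * ((1300 + 4 * Real.sqrt 2) * |β'|) + (1 - 12 * |β'|)) := by
    rw [htstar]
    field_simp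
  have hEXPO : Real.exp (-((1 - 12 * |β'|) * (((R : ℝ) + 1) * Real.log 2) / (2 * ((1300 + 4 * Real.sqrt 2) * |β'|) + (1 - 12 * |β'|)))) = Real.exp (-((1 - 12 * |β'|) / 2 * tstar)) := by rw [htarget, hs, mul_div_assoc]
  have hCw0 : 0 ≤ (24 * Real.sqrt 2 * Real.pi * (l.length : ℝ) ^ 2) := by positivity
  have hC1 : 1 ≤ (6 * (7 + 6 * ((1300 + 4 * Real.sqrt 2) * |β'|) / (1 - 12 * |β'|)) ^ 3 + 2) := by
    have h7 : 0 ≤ 7 + 6 * ((1300 + 4 * Real.sqrt 2) * |β'|) / (1 - 12 * |β'|) := by positivity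
    nlinarith [pow_nonneg h7 3]
  have hC10 : 0 ≤ (6 * (7 + 6 * ((1300 + 4 * Real.sqrt 2) * |β'|) / (1 - 12 * |β'|)) ^ 3 + 2) := le_trans zero_le_one hC1
  rw [hEXPO]
  by_cases ht : (t : ℝ) ≤ tstar
  · -- short times: the light cone
    have hLC := word_lightCone L β' κ hreal l t R y y' hyy'
    have hpow : ((2 : ℝ)⁻¹) ^ (R + 1) = Real.exp (-s) := by
      rw [hs, Real.exp_neg, show ((R : ℝ) + 1) = ((R + 1 : ℕ) : ℝ) by push_cast; ring, Real.exp_nat_mul,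
        Real.exp_log (by norm_num : (0 : ℝ) < 2), inv_pow]
    have hexp : Real.exp ((|β'| * (4 + 4 * Real.sqrt 2 + 12 * 108)) * (t : ℝ)) * ((2 : ℝ)⁻¹) ^ (R + 1) ≤ Real.exp (-((1 - 12 * |β'|) / 2 * tstar)) := by
      rw [hpow, ← Real.exp_add, hlamK]
      refine Real.exp_le_exp.2 ?_
      have h1 : ((1300 + 4 * Real.sqrt 2) * |β'|) * (t : ℝ) ≤ ((1300 + 4 * Real.sqrt 2) * |β'|) * tstar := mul_le_mul_of_nonneg_left ht hlam0
      linarith [hsplit]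
    calc |∫ z, (fun y : (Edge 3 L × Fin 2 × Fin 2 × Bool → ℝ) => ((l.map (fun a : Edge 3 L × Bool => if a.2 then ((fun (ee : Edge 3 L) => Matrix.of fun (i j : Fin 2) => ((y (ee, i, j, false) : ℝ) : ℂ) + ((y (ee, i, j, true) : ℝ) : ℂ) * Complex.I) a.1)ᴴ else (fun (ee : Edge 3 L) => Matrix.of fun (i j : Fin 2) => ((y (ee, i, j, false) : ℝ) : ℂ) + ((y (ee, i, j, true) : ℝ) : ℂ) * Complex.I) a.1)).prod).trace.re) (coords z) ∂(κ t y) - ∫ z, (fun y : (Edge 3 L × Fin 2 × Fin 2 × Bool → ℝ) => ((l.map (fun a : Edge 3 L × Bool => if a.2 then ((fun (ee : Edge 3 L) => Matrix.of fun (i j : Fin 2) => ((y (ee, i, j, false) : ℝ) : ℂ) + ((y (ee, i, j, true) : ℝ) : ℂ) * Complex.I) a.1)ᴴ else (fun (ee : Edge 3 L) => Matrix.of fun (i j : Fin 2) => ((y (ee, i, j, false) : ℝ) : ℂ) + ((y (ee, i, j, true) : ℝ) : ℂ) * Complex.I) a.1)).prod).trace.re) (coords z) ∂(κ t y')|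
        ≤ (24 * Real.sqrt 2 * Real.pi * (l.length : ℝ) ^ 2) * Real.exp ((|β'| * (4 + 4 * Real.sqrt 2 + 12 * 108)) * (t : ℝ)) * ((2 : ℝ)⁻¹) ^ (R + 1) := hLC
      _ = (24 * Real.sqrt 2 * Real.pi * (l.length : ℝ) ^ 2) * (Real.exp ((|β'| * (4 + 4 * Real.sqrt 2 + 12 * 108)) * (t : ℝ)) * ((2 : ℝ)⁻¹) ^ (R + 1)) := by ring
      _ ≤ (24 * Real.sqrt 2 * Real.pi * (l.length : ℝ) ^ 2) * Real.exp (-((1 - 12 * |β'|) / 2 * tstar)) := mul_le_mul_of_nonneg_left hexp hCw0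
      _ = (24 * Real.sqrt 2 * Real.pi * (l.length : ℝ) ^ 2) * 1 * Real.exp (-((1 - 12 * |β'|) / 2 * tstar)) := by ring
      _ ≤ (24 * Real.sqrt 2 * Real.pi * (l.length : ℝ) ^ 2) * (6 * (7 + 6 * ((1300 + 4 * Real.sqrt 2) * |β'|) / (1 - 12 * |β'|)) ^ 3 + 2) * Real.exp (-((1 - 12 * |β'|) / 2 * tstar)) :=
          mul_le_mul_of_nonneg_right (mul_le_mul_of_nonneg_left hC1 hCw0) (Real.exp_pos _).le
  · -- long times: every-start mixing of both starts
    push Not at ht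
    have hm := wilson_word_mixing_halfRate L β' hβ κ hreal l t y
    have hm' := wilson_word_mixing_halfRate L β' hβ κ hreal l t y'
    have hexp : Real.exp (-((1 - 12 * |β'|) / 2 * (t : ℝ))) ≤ Real.exp (-((1 - 12 * |β'|) / 2 * tstar)) :=
      Real.exp_le_exp.2 (by nlinarith [ht, hρ])
    have hK : 0 ≤ 12 * Real.sqrt 2 * Real.pi * (l.length : ℝ) ^ 2 * (6 * (7 + 6 * ((1300 + 4 * Real.sqrt 2) * |β'|) / (1 - 12 * |β'|)) ^ 3 + 2) := by positivity
    calc |∫ z, (fun y : (Edge 3 L × Fin 2 × Fin 2 × Bool → ℝ) => ((l.map (fun a : Edge 3 L × Bool => if a.2 then ((fun (ee : Edge 3 L) => Matrix.of fun (i j : Fin 2) => ((y (ee, i, j, false) : ℝ) : ℂ) + ((y (ee, i, j, true) : ℝ) : ℂ) * Complex.I) a.1)ᴴ else (fun (ee : Edge 3 L) => Matrix.of fun (i j : Fin 2) => ((y (ee, i, j, false) : ℝ) : ℂ) + ((y (ee, i, j, true) : ℝ) : ℂ) * Complex.I) a.1)).prod).trace.re) (coords z) ∂(κ t y) - ∫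 z, (fun y : (Edge 3 L × Fin 2 × Fin 2 × Bool → ℝ) => ((l.map (fun a : Edge 3 L × Bool => if a.2 then ((fun (ee : Edge 3 L) => Matrix.of fun (i j : Fin 2) => ((y (ee, i, j, false) : ℝ) : ℂ) + ((y (ee, i, j, true) : ℝ) : ℂ) * Complex.I) a.1)ᴴ else (fun (ee : Edge 3 L) => Matrix.of fun (i j : Fin 2) => ((y (ee, i, j, false) : ℝ) : ℂ) + ((y (ee, i, j, true) : ℝ) : ℂ) * Complex.I) a.1)).prod).trace.re) (coords z) ∂(κ t y')|
        = |(∫ z, (fun y : (Edge 3 L × Fin 2 × Fin 2 × Bool → ℝ) => ((l.map (fun a : Edge 3 L × Bool => if a.2 then ((fun (ee : Edge 3 L) => Matrix.of fun (i j : Fin 2) => ((y (ee, i, j, false) : ℝ) : ℂ) + ((y (ee, i, j, true) : ℝ) : ℂ) * Complex.I) a.1)ᴴ else (fun (ee : Edge 3 L) => Matrix.of fun (i j : Fin 2) => ((y (ee, i, j, false) : ℝ) : ℂ) + ((y (ee, i, j, true) : ℝ) : ℂ) * Complex.I) a.1)).prod).trace.re) (coords z) ∂(κ t y) - ∫ z,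 (fun y : (Edge 3 L × Fin 2 × Fin 2 × Bool → ℝ) => ((l.map (fun a : Edge 3 L × Bool => if a.2 then ((fun (ee : Edge 3 L) => Matrix.of fun (i j : Fin 2) => ((y (ee, i, j, false) : ℝ) : ℂ) + ((y (ee, i, j, true) : ℝ) : ℂ) * Complex.I) a.1)ᴴ else (fun (ee : Edge 3 L) => Matrix.of fun (i j : Fin 2) => ((y (ee, i, j, false) : ℝ) : ℂ) + ((y (ee, i, j, true) : ℝ) : ℂ) * Complex.I) a.1)).prod).trace.re) (coords z) ∂(wilsonMeasure (d := 3) (L := L) (fundamentalRep (Fin 2)) β')) -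
            (∫ z, (fun y : (Edge 3 L × Fin 2 × Fin 2 × Bool → ℝ) => ((l.map (fun a : Edge 3 L × Bool => if a.2 then ((fun (ee : Edge 3 L) => Matrix.of fun (i j : Fin 2) => ((y (ee, i, j, false) : ℝ) : ℂ) + ((y (ee, i, j, true) : ℝ) : ℂ) * Complex.I) a.1)ᴴ else (fun (ee : Edge 3 L) => Matrix.of fun (i j : Fin 2) => ((y (ee, i, j, false) : ℝ) : ℂ) + ((y (ee, i, j, true) : ℝ) : ℂ) * Complex.I) a.1)).prod).trace.re) (coords z) ∂(κ t y') - ∫ z, (fun y : (Edge 3 L × Fin 2 × Fin 2 × Bool → ℝ) => ((l.map (fun a : Edge 3 L × Bool => if a.2 then ((fun (ee : Edge 3 L) => Matrix.of fun (i j : Fin 2) => ((y (ee, i, j, false) : ℝ) : ℂ) + ((y (ee, i, j, true) : ℝ) : ℂ) * Complex.I) a.1)ᴴ else (fun (ee : Edge 3 L) => Matrix.of fun (i j : Fin 2) => ((y (ee, i, j, false) : ℝ) : ℂ) + ((y (ee, i, j, true) : ℝ) : ℂ) * Complex.I) a.1)).prod).trace.re) (coords z) ∂(wilsonMeasure (d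 := 3) (L := L) (fundamentalRep (Fin 2)) β'))| := by congr 1; ring
      _ ≤ |∫ z, (fun y : (Edge 3 L × Fin 2 × Fin 2 × Bool → ℝ) => ((l.map (fun a : Edge 3 L × Bool => if a.2 then ((fun (ee : Edge 3 L) => Matrix.of fun (i j : Fin 2) => ((y (ee, i, j, false) : ℝ) : ℂ) + ((y (ee, i, j, true) : ℝ) : ℂ) * Complex.I) a.1)ᴴ else (fun (ee : Edge 3 L) => Matrix.of fun (i j : Fin 2) => ((y (ee, i, j, false) : ℝ) : ℂ) + ((y (ee, i, j, true) : ℝ) : ℂ) * Complex.I) a.1)).prod).trace.re) (coords z) ∂(κ t y) - ∫ z, (fun y : (Edge 3 L × Fin 2 × Fin 2 × Bool → ℝ) => ((l.map (fun a : Edge 3 L × Bool => if a.2 then ((fun (ee : Edge 3 L) => Matrix.of fun (i j : Fin 2) => ((y (ee, i, j, false) : ℝ) : ℂ) + ((y (ee, i, j, true) : ℝ) : ℂ) * Complex.I) a.1)ᴴ else (fun (ee : Edge 3 L) => Matrix.of fun (i j : Fin 2) => ((y (ee, i, j, false) : ℝ) : ℂ) + ((y (ee, i, j, true) : ℝ)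 : ℂ) * Complex.I) a.1)).prod).trace.re) (coords z) ∂(wilsonMeasure (d := 3) (L := L) (fundamentalRep (Fin 2)) β')| +
            |∫ z, (fun y : (Edge 3 L × Fin 2 × Fin 2 × Bool → ℝ) => ((l.map (fun a : Edge 3 L × Bool => if a.2 then ((fun (ee : Edge 3 L) => Matrix.of fun (i j : Fin 2) => ((y (ee, i, j, false) : ℝ) : ℂ) + ((y (ee, i, j, true) : ℝ) : ℂ) * Complex.I) a.1)ᴴ else (fun (ee : Edge 3 L) => Matrix.of fun (i j : Fin 2) => ((y (ee, i, j, false) : ℝ) : ℂ) + ((y (ee, i, j, true) : ℝ) : ℂ) * Complex.I) a.1)).prod).trace.re) (coords z) ∂(κ t y') - ∫ z, (fun y : (Edge 3 L × Fin 2 × Fin 2 × Bool → ℝ) => ((l.map (fun a : Edge 3 L × Bool => if a.2 then ((fun (ee : Edge 3 L) => Matrix.of fun (i j : Fin 2) => ((y (ee, i, j, false) : ℝ) : ℂ) + ((y (ee, i, j, true) : ℝ) : ℂ) * Complex.I) a.1)ᴴ else (fun (ee : Edge 3 L) => Matrix.of fun (i j : Fin 2) => ((y (ee, i, j, false) : ℝ)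 : ℂ) + ((y (ee, i, j, true) : ℝ) : ℂ) * Complex.I) a.1)).prod).trace.re) (coords z) ∂(wilsonMeasure (d := 3) (L := L) (fundamentalRep (Fin 2)) β')| := abs_sub _ _
      _ ≤ 12 * Real.sqrt 2 * Real.pi * (l.length : ℝ) ^ 2 * (6 * (7 + 6 * ((1300 + 4 * Real.sqrt 2) * |β'|) / (1 - 12 * |β'|)) ^ 3 + 2) * Real.exp (-((1 - 12 * |β'|) / 2 * (t : ℝ))) +
            12 * Real.sqrt 2 * Real.pi * (l.length : ℝ) ^ 2 * (6 * (7 + 6 * ((1300 + 4 * Real.sqrt 2) * |β'|) / (1 - 12 * |β'|)) ^ 3 + 2) * Real.exp (-((1 - 12 * |β'|) / 2 * (t : ℝ))) := add_le_add hm hm'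
      _ = (24 * Real.sqrt 2 * Real.pi * (l.length : ℝ) ^ 2) * (6 * (7 + 6 * ((1300 + 4 * Real.sqrt 2) * |β'|) / (1 - 12 * |β'|)) ^ 3 + 2) * Real.exp (-((1 - 12 * |β'|) / 2 * (t : ℝ))) := by ring
      _ ≤ (24 * Real.sqrt 2 * Real.pi * (l.length : ℝ) ^ 2) * (6 * (7 + 6 * ((1300 + 4 * Real.sqrt 2) * |β'|) / (1 - 12 * |β'|)) ^ 3 + 2) * Real.exp (-((1 - 12 * |β'|) / 2 * tstar)) := mul_le_mul_of_nonneg_left hexp (mul_nonneg hCw0 hC10)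

/-- ★★★ **The same for a general local observable** (`|β'| < 1/12`, every volume): `f` of class `C⁵` in the flat link coordinates with a
link-Lipschitz profile `ℓ ≥ 0` supported in `Λ`; starts `y, y'` agreeing on the `R`-ball around `Λ`; then FOR ALL `t ≥ 0`:
`|κ_t(f∘coords)(y) − κ_t(f∘coords)(y')| ≤ (12√2·Σℓ + 24π·#Λ·√(Σℓ²)·(6(7+6λ/ρ)³+2))·exp(−ρ(R+1)log 2/(2λ+ρ))`
(light cone `transitionKernel_lightCone` for `t ≤ t*`, `wilson_local_mixing_halfRate_of_linkLipschitz` for both starts after). [folklore] -/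
theorem local_farStart_uniform_in_time (L : ℕ) [NeZero L] (β' : ℝ) (hβ : |β'| < 1 / 12)
    (κ : ℝ≥0 → Kernel (GaugeConfig 3 L (Matrix.specialUnitaryGroup (Fin 2) ℂ))
      (GaugeConfig 3 L (Matrix.specialUnitaryGroup (Fin 2) ℂ))) [∀ t, IsMarkovKernel (κ t)]
    (hreal : ∀ (t : ℝ≥0) (x : GaugeConfig 3 L (Matrix.specialUnitaryGroup (Fin 2) ℂ))
        (Ω : Type) [MeasurableSpace Ω] (P : Measure Ω) [IsProbabilityMeasure P]
        (W : ℝ≥0 → Ω → (Edge 3 L × NoiseIdx 2 → ℝ)) (hW : IsFlatBrownian W P)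
        (U : ℝ≥0 → Ω → GaugeConfig 3 L (Matrix.specialUnitaryGroup (Fin 2) ℂ)),
        (∀ ω, U 0 ω = x) →
        (latticeLangevinDynamics (fundamentalLatticeRep 2) β').IsSolution (fundamentalRep (Fin 2))
          hW.natFiltration P W U →
        κ t x = P.map (U t))
    {f : (Edge 3 L × Fin 2 × Fin 2 × Bool → ℝ) → ℝ} (hf : ContDiff ℝ 5 f) (Λ : Finset (Edge 3 L)) {ℓ : Edge 3 L → ℝ} (hℓ : ∀ e, 0 ≤ ℓ e)
    (hℓΛ : ∀ e, e ∉ Λ → ℓ e = 0) (R : ℕ) (y y' : (GaugeConfig 3 L (Matrix.specialUnitaryGroup (Fin 2) ℂ)))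
    (hyy' : ∀ e₀ : Edge 3 L, (∃ e ∈ Λ, (Finset.univ.sup fun i : Fin 3 => ((e.1 i - e₀.1 i).valMinAbs).natAbs) ≤ R) → y e₀ = y' e₀) (t : ℝ≥0) :
    let coords : GaugeConfig 3 L (Matrix.specialUnitaryGroup (Fin 2) ℂ) → (Edge 3 L × Fin 2 × Fin 2 × Bool → ℝ) :=
      fun V q => (fun z : ℂ => if q.2.2.2 then z.im else z.re)
        ((fundamentalRep (Fin 2) (V q.1) : Matrix (Fin 2) (Fin 2) ℂ) q.2.1 q.2.2.1)
    (∀ (e : Edge 3 L) (y y' : (GaugeConfig 3 L (Matrix.specialUnitaryGroup (Fin 2) ℂ))), (∀ g, g ≠ e → y g = y' g) →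
      |f (coords y) - f (coords y')| ≤ ℓ e * frobNorm ((y e : Matrix (Fin 2) (Fin 2) ℂ) - (y' e : Matrix (Fin 2) (Fin 2) ℂ))) →
    |∫ z, f (coords z) ∂(κ t y) - ∫ z, f (coords z) ∂(κ t y')| ≤ (12 * Real.sqrt 2 * (∑ e : Edge 3 L, ℓ e) + 24 * Real.pi * Λ.card * Real.sqrt (∑ e : Edge 3 L, ℓ e ^ 2) * (6 * (7 + 6 * ((1300 + 4 * Real.sqrt 2) * |β'|) / (1 - 12 * |β'|)) ^ 3 + 2)) * Real.exp (-((1 - 12 * |β'|) * (((R : ℝ) + 1) * Real.log 2) / (2 * ((1300 + 4 * Real.sqrt 2) * |β'|) + (1 - 12 * |β'|)))) := by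
  intro coords hLip
  have hρ : 0 < (1 - 12 * |β'|) := by linarith
  have hlam0 : 0 ≤ ((1300 + 4 * Real.sqrt 2) * |β'|) := by positivity
  have hlamK : (|β'| * (4 + 4 * Real.sqrt 2 + 12 * 108)) = ((1300 + 4 * Real.sqrt 2) * |β'|) := by ring
  set s : ℝ := ((R : ℝ) + 1) * Real.log 2 with hs
  have hlog2 : 0 < Real.log 2 := Real.log_pos (by norm_num)
  have hs0 : 0 ≤ s := by rw [hs]; positivity
  have hden : 0 < ((1300 + 4 * Real.sqrt 2) * |β'|) + (1 - 12 * |β'|) / 2 := by linarith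
  set tstar : ℝ := s / (((1300 + 4 * Real.sqrt 2) * |β'|) + (1 - 12 * |β'|) / 2) with htstar
  have htstar0 : 0 ≤ tstar := div_nonneg hs0 hden.le
  have hsplit : ((1300 + 4 * Real.sqrt 2) * |β'|) * tstar + (1 - 12 * |β'|) / 2 * tstar = s := by
    rw [← add_mul, htstar, mul_div_cancel₀ s hden.ne']
  have htarget : (1 - 12 * |β'|) / 2 * tstar = (1 - 12 * |β'|) * s / (2 * ((1300 + 4 * Real.sqrt 2) * |β'|) + (1 - 12 * |β'|)) := by
    rw [htstar]
    field_simp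
  have hEXPO : Real.exp (-((1 - 12 * |β'|) * (((R : ℝ) + 1) * Real.log 2) / (2 * ((1300 + 4 * Real.sqrt 2) * |β'|) + (1 - 12 * |β'|)))) = Real.exp (-((1 - 12 * |β'|) / 2 * tstar)) := by rw [htarget, hs, mul_div_assoc]
  have hSℓ : 0 ≤ ∑ e : Edge 3 L, ℓ e := Finset.sum_nonneg fun e _ => hℓ e
  have hA0 : 0 ≤ 12 * Real.sqrt 2 * (∑ e : Edge 3 L, ℓ e) := by positivity
  have hB0 : 0 ≤ 24 * Real.pi * Λ.card * Real.sqrt (∑ e : Edge 3 L, ℓ e ^ 2) * (6 * (7 + 6 * ((1300 + 4 * Real.sqrt 2) * |β'|) / (1 - 12 * |β'|)) ^ 3 + 2) := by positivity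
  have hE0 : 0 ≤ Real.exp (-((1 - 12 * |β'|) / 2 * tstar)) := (Real.exp_pos _).le
  rw [hEXPO]
  by_cases ht : (t : ℝ) ≤ tstar
  · -- short times: the light cone
    have hFc : Continuous fun z : (GaugeConfig 3 L (Matrix.specialUnitaryGroup (Fin 2) ℂ)) => f (coords z) := hf.continuous.comp (continuous_coords (L := L))
    have hLC := transitionKernel_lightCone L β' κ hreal hFc hℓ hLip Λ hℓΛ t R y y' hyy'
    have hpow : ((2 : ℝ)⁻¹) ^ (R + 1) = Real.exp (-s) := by
      rw [hs, Real.exp_neg, show ((R : ℝ) + 1) = ((R + 1 : ℕ) : ℝ) by push_cast; ring, Real.exp_nat_mul,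
        Real.exp_log (by norm_num : (0 : ℝ) < 2), inv_pow]
    have hexp : Real.exp ((|β'| * (4 + 4 * Real.sqrt 2 + 12 * 108)) * (t : ℝ)) * ((2 : ℝ)⁻¹) ^ (R + 1) ≤ Real.exp (-((1 - 12 * |β'|) / 2 * tstar)) := by
      rw [hpow, ← Real.exp_add, hlamK]
      refine Real.exp_le_exp.2 ?_
      have h1 : ((1300 + 4 * Real.sqrt 2) * |β'|) * (t : ℝ) ≤ ((1300 + 4 * Real.sqrt 2) * |β'|) * tstar := mul_le_mul_of_nonneg_left ht hlam0
      linarith [hsplit]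
    calc |∫ z, f (coords z) ∂(κ t y) - ∫ z, f (coords z) ∂(κ t y')|
        ≤ 12 * Real.sqrt 2 * Real.exp ((|β'| * (4 + 4 * Real.sqrt 2 + 12 * 108)) * (t : ℝ)) * ((2 : ℝ)⁻¹) ^ (R + 1) * ∑ e : Edge 3 L, ℓ e := hLC
      _ = 12 * Real.sqrt 2 * (∑ e : Edge 3 L, ℓ e) * (Real.exp ((|β'| * (4 + 4 * Real.sqrt 2 + 12 * 108)) * (t : ℝ)) * ((2 : ℝ)⁻¹) ^ (R + 1)) := by ring
      _ ≤ 12 * Real.sqrt 2 * (∑ e : Edge 3 L, ℓ e) * Real.exp (-((1 - 12 * |β'|) / 2 * tstar)) := mul_le_mul_of_nonneg_left hexp hA0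
      _ ≤ (12 * Real.sqrt 2 * (∑ e : Edge 3 L, ℓ e) + 24 * Real.pi * Λ.card * Real.sqrt (∑ e : Edge 3 L, ℓ e ^ 2) * (6 * (7 + 6 * ((1300 + 4 * Real.sqrt 2) * |β'|) / (1 - 12 * |β'|)) ^ 3 + 2)) * Real.exp (-((1 - 12 * |β'|) / 2 * tstar)) := mul_le_mul_of_nonneg_right (by linarith) hE0
  · -- long times: every-start mixing of both starts
    push Not at ht
    have hm := wilson_local_mixing_halfRate_of_linkLipschitz L β' hβ κ hreal hf Λ hℓ hℓΛ t hLip y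
    have hm' := wilson_local_mixing_halfRate_of_linkLipschitz L β' hβ κ hreal hf Λ hℓ hℓΛ t hLip y'
    have hexp : Real.exp (-((1 - 12 * |β'|) / 2 * (t : ℝ))) ≤ Real.exp (-((1 - 12 * |β'|) / 2 * tstar)) :=
      Real.exp_le_exp.2 (by nlinarith [ht, hρ])
    calc |∫ z, f (coords z) ∂(κ t y) - ∫ z, f (coords z) ∂(κ t y')|
        = |(∫ z, f (coords z) ∂(κ t y) - ∫ z, f (coords z) ∂(wilsonMeasure (d := 3) (L := L) (fundamentalRep (Fin 2)) β')) -
            (∫ z, f (coords z) ∂(κ t y') - ∫ z, f (coords z) ∂(wilsonMeasure (d := 3) (L := L) (fundamentalRep (Fin 2)) β'))| := by congr 1; ring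
      _ ≤ |∫ z, f (coords z) ∂(κ t y) - ∫ z, f (coords z) ∂(wilsonMeasure (d := 3) (L := L) (fundamentalRep (Fin 2)) β')| +
            |∫ z, f (coords z) ∂(κ t y') - ∫ z, f (coords z) ∂(wilsonMeasure (d := 3) (L := L) (fundamentalRep (Fin 2)) β')| := abs_sub _ _
      _ ≤ 12 * Real.pi * Λ.card * Real.sqrt (∑ e : Edge 3 L, ℓ e ^ 2) * (6 * (7 + 6 * ((1300 + 4 * Real.sqrt 2) * |β'|) / (1 - 12 * |β'|)) ^ 3 + 2) * Real.exp (-((1 - 12 * |β'|) / 2 * (t : ℝ))) +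
            12 * Real.pi * Λ.card * Real.sqrt (∑ e : Edge 3 L, ℓ e ^ 2) * (6 * (7 + 6 * ((1300 + 4 * Real.sqrt 2) * |β'|) / (1 - 12 * |β'|)) ^ 3 + 2) * Real.exp (-((1 - 12 * |β'|) / 2 * (t : ℝ))) := add_le_add hm hm'
      _ = 24 * Real.pi * Λ.card * Real.sqrt (∑ e : Edge 3 L, ℓ e ^ 2) * (6 * (7 + 6 * ((1300 + 4 * Real.sqrt 2) * |β'|) / (1 - 12 * |β'|)) ^ 3 + 2) * Real.exp (-((1 - 12 * |β'|) / 2 * (t : ℝ))) := by ring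
      _ ≤ 24 * Real.pi * Λ.card * Real.sqrt (∑ e : Edge 3 L, ℓ e ^ 2) * (6 * (7 + 6 * ((1300 + 4 * Real.sqrt 2) * |β'|) / (1 - 12 * |β'|)) ^ 3 + 2) * Real.exp (-((1 - 12 * |β'|) / 2 * tstar)) :=
          mul_le_mul_of_nonneg_left hexp hB0
      _ ≤ (12 * Real.sqrt 2 * (∑ e : Edge 3 L, ℓ e) + 24 * Real.pi * Λ.card * Real.sqrt (∑ e : Edge 3 L, ℓ e ^ 2) * (6 * (7 + 6 * ((1300 + 4 * Real.sqrt 2) * |β'|) / (1 - 12 * |β'|)) ^ 3 + 2)) * Real.exp (-((1 - 12 * |β'|) / 2 * tstar)) := mul_le_mul_of_nonneg_right (by linarith) hE0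

/-! ## §3. Along strong solutions -/

/-- ★★★ **Along strong SZZ solutions** (`|β'| < 1/12`, every volume): two strong solutions from deterministic starts agreeing on the
`R`-ball around the links of `w` (e.g. the COLD start and a start modified only at distance `> R` from the loop), on possibly different
filtered probability spaces, satisfy FOR ALL `t`: `|E[Re tr w(U_t)] − E'[Re tr w(U'_t)]| ≤ 24√2π|w|²(6(7+6λ/ρ)³+2)·exp(−ρ(R+1)log 2/(2λ+ρ))`.
[folklore] -/
theorem solution_word_farStart_uniform_in_time (L : ℕ) [NeZero L] (β' : ℝ) (hβ : |β'| < 1 / 12) (t : ℝ≥0)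
    (l : List (Edge 3 L × Bool)) (R : ℕ) (y y' : (GaugeConfig 3 L (Matrix.specialUnitaryGroup (Fin 2) ℂ)))
    (hyy' : ∀ e₀ : Edge 3 L, (∃ e ∈ (l.map Prod.fst).toFinset, (Finset.univ.sup fun i : Fin 3 => ((e.1 i - e₀.1 i).valMinAbs).natAbs) ≤ R) → y e₀ = y' e₀)
    (Ω : Type) [MeasurableSpace Ω] (P : Measure Ω) [IsProbabilityMeasure P]
    (W : ℝ≥0 → Ω → (Edge 3 L × NoiseIdx 2 → ℝ)) (hW : IsFlatBrownian W P)
    (U : ℝ≥0 → Ω → (GaugeConfig 3 L (Matrix.specialUnitaryGroup (Fin 2) ℂ))) (hU0 : ∀ ω, U 0 ω = y)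
    (hU : (latticeLangevinDynamics (fundamentalLatticeRep 2) β').IsSolution (fundamentalRep (Fin 2)) hW.natFiltration P W U)
    (Ω' : Type) [MeasurableSpace Ω'] (P' : Measure Ω') [IsProbabilityMeasure P']
    (W' : ℝ≥0 → Ω' → (Edge 3 L × NoiseIdx 2 → ℝ)) (hW' : IsFlatBrownian W' P')
    (U' : ℝ≥0 → Ω' → (GaugeConfig 3 L (Matrix.specialUnitaryGroup (Fin 2) ℂ))) (hU0' : ∀ ω, U' 0 ω = y')
    (hU' : (latticeLangevinDynamics (fundamentalLatticeRep 2) β').IsSolution (fundamentalRep (Fin 2)) hW'.natFiltration P' W' U') :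
    let coords : GaugeConfig 3 L (Matrix.specialUnitaryGroup (Fin 2) ℂ) → (Edge 3 L × Fin 2 × Fin 2 × Bool → ℝ) :=
      fun V q => (fun z : ℂ => if q.2.2.2 then z.im else z.re)
        ((fundamentalRep (Fin 2) (V q.1) : Matrix (Fin 2) (Fin 2) ℂ) q.2.1 q.2.2.1)
    |∫ ω, (fun y : (Edge 3 L × Fin 2 × Fin 2 × Bool → ℝ) => ((l.map (fun a : Edge 3 L × Bool => if a.2 then ((fun (ee : Edge 3 L) => Matrix.of fun (i j : Fin 2) => ((y (ee, i, j, false) : ℝ) : ℂ) + ((y (ee, i, j, true) : ℝ) : ℂ) * Complex.I) a.1)ᴴ else (fun (ee : Edge 3 L) => Matrix.of fun (i j : Fin 2) => ((y (ee, i, j, false) : ℝ) : ℂ) + ((y (ee, i, j, true) : ℝ) : ℂ) * Complex.I) a.1)).prod).trace.re) (coords (U t ω)) ∂P - ∫ ω, (fun y : (Edge 3 L × Fin 2 × Fin 2 × Bool → ℝ) => ((l.map (fun a : Edge 3 L × Bool => if a.2 then ((fun (ee : Edge 3 L) => Matrix.of fun (i j : Fin 2) => ((y (ee, i, j, false) :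 ℝ) : ℂ) + ((y (ee, i, j, true) : ℝ) : ℂ) * Complex.I) a.1)ᴴ else (fun (ee : Edge 3 L) => Matrix.of fun (i j : Fin 2) => ((y (ee, i, j, false) : ℝ) : ℂ) + ((y (ee, i, j, true) : ℝ) : ℂ) * Complex.I) a.1)).prod).trace.re) (coords (U' t ω)) ∂P'| ≤ (24 * Real.sqrt 2 * Real.pi * (l.length : ℝ) ^ 2) * (6 * (7 + 6 * ((1300 + 4 * Real.sqrt 2) * |β'|) / (1 - 12 * |β'|)) ^ 3 + 2) * Real.exp (-((1 - 12 * |β'|) * (((R : ℝ) + 1) * Real.log 2) / (2 * ((1300 + 4 * Real.sqrt 2) * |β'|) + (1 - 12 * |β'|)))) := by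
  intro coords
  classical
  haveI := secondCountableTopology_su2
  haveI := borelSpace_config L
  obtain ⟨κ, hκ, -, hreal⟩ := exists_transitionKernel L β'
  haveI := hκ
  have h := word_farStart_uniform_in_time L β' hβ κ hreal l R y y' hyy' t
  have hlaw : κ t y = P.map (U t) := hreal t y Ω P W hW U hU0 hU
  have hlaw' : κ t y' = P'.map (U' t) := hreal t y' Ω' P' W' hW' U' hU0' hU'
  have hmU : Measurable (U t) := (hU.adapted t).mono (hW.natFiltration.le t) le_rfl
  have hmU' : Measurable (U' t) := (hU'.adapted t).mono (hW'.natFiltration.le t) le_rfl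
  have hFm : Measurable fun u : (GaugeConfig 3 L (Matrix.specialUnitaryGroup (Fin 2) ℂ)) => (fun y : (Edge 3 L × Fin 2 × Fin 2 × Bool → ℝ) => ((l.map (fun a : Edge 3 L × Bool => if a.2 then ((fun (ee : Edge 3 L) => Matrix.of fun (i j : Fin 2) => ((y (ee, i, j, false) : ℝ) : ℂ) + ((y (ee, i, j, true) : ℝ) : ℂ) * Complex.I) a.1)ᴴ else (fun (ee : Edge 3 L) => Matrix.of fun (i j : Fin 2) => ((y (ee, i, j, false) : ℝ) : ℂ) + ((y (ee, i, j, true) : ℝ) : ℂ) * Complex.I) a.1)).prod).trace.re) (coords u) :=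
    ((contDiff_word (L := L) l (m := 1)).continuous.comp (continuous_coords (L := L))).measurable
  have e1 : ∫ z, (fun y : (Edge 3 L × Fin 2 × Fin 2 × Bool → ℝ) => ((l.map (fun a : Edge 3 L × Bool => if a.2 then ((fun (ee : Edge 3 L) => Matrix.of fun (i j : Fin 2) => ((y (ee, i, j, false) : ℝ) : ℂ) + ((y (ee, i, j, true) : ℝ) : ℂ) * Complex.I) a.1)ᴴ else (fun (ee : Edge 3 L) => Matrix.of fun (i j : Fin 2) => ((y (ee, i, j, false) : ℝ) : ℂ) + ((y (ee, i, j, true) : ℝ) : ℂ) * Complex.I) a.1)).prod).trace.re) (coords z) ∂(κ t y) = ∫ ω, (fun y : (Edge 3 L × Fin 2 × Fin 2 × Bool → ℝ) => ((l.map (fun a : Edge 3 L × Bool => if a.2 then ((fun (ee : Edge 3 L) => Matrix.of fun (i j : Fin 2) => ((y (ee, i, j, false) : ℝ) : ℂ) + ((y (ee, i, j, true) : ℝ) : ℂ) * Complex.I) a.1)ᴴ else (fun (ee : Edge 3 L) => Matrix.of fun (i j : Fin 2) => ((y (ee, i, j, false) : ℝ) : ℂ) + ((y (ee, i, j, true)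 : ℝ) : ℂ) * Complex.I) a.1)).prod).trace.re) (coords (U t ω)) ∂P := by
    rw [hlaw, integral_map hmU.aemeasurable hFm.aestronglyMeasurable]
  have e2 : ∫ z, (fun y : (Edge 3 L × Fin 2 × Fin 2 × Bool → ℝ) => ((l.map (fun a : Edge 3 L × Bool => if a.2 then ((fun (ee : Edge 3 L) => Matrix.of fun (i j : Fin 2) => ((y (ee, i, j, false) : ℝ) : ℂ) + ((y (ee, i, j, true) : ℝ) : ℂ) * Complex.I) a.1)ᴴ else (fun (ee : Edge 3 L) => Matrix.of fun (i j : Fin 2) => ((y (ee, i, j, false) : ℝ) : ℂ) + ((y (ee, i, j, true) : ℝ) : ℂ) * Complex.I) a.1)).prod).trace.re) (coords z) ∂(κ t y') = ∫ ω, (fun y : (Edge 3 L × Fin 2 × Fin 2 × Bool → ℝ) => ((l.map (fun a : Edge 3 L × Bool => if a.2 then ((fun (ee : Edge 3 L) => Matrix.of fun (i j : Fin 2) => ((y (ee, i, j, false) : ℝ) : ℂ) + ((y (ee, i, j, true) : ℝ) : ℂ) * Complex.I) a.1)ᴴ else (fun (ee : Edge 3 L) => Matrix.of fun (i j : Fin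 2) => ((y (ee, i, j, false) : ℝ) : ℂ) + ((y (ee, i, j, true) : ℝ) : ℂ) * Complex.I) a.1)).prod).trace.re) (coords (U' t ω)) ∂P' := by
    rw [hlaw', integral_map hmU'.aemeasurable hFm.aestronglyMeasurable]
  rw [← e1, ← e2]
  exact h

end Summit.QuantumFields.YangMills.Theorems.ColdStartUniversality.LiebRobinson
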